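import Literature.NumberTheory.LFunctions.CriticalLineTwoThirds
import Literature.NumberTheory.LFunctions.XiDerivativeZerosCounting
import HarnessLib

/-!
# RH-FREE — «nothing here bears on the truth of RH»: Alpöge–Furman 2026 Remark 7.1 (zeros of `ξ′`, claim) ⟹ Conrey 1983's corollary `κ′₁ ≥ 0.8137` (named fact `conrey1983_xiDeriv_one`)

Topic `Literature/NumberTheory/LFunctions` (namespace `Literature.NumberTheory.LFunctions`). PROOF
LAYER glue (three theorems, nothing asserted, no definition, no named fact) between

* the statement file `CriticalLineTwoThirds.lean` — L. Alpöge, R. Furman, *More than two thirds of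
  the zeros of the Riemann zeta function are simple and on the critical line*, arXiv:2608.13637v2
  (2026), **Remark 7.1** (p. 14): "unconditionally `liminf N^s_{0,ξ′}(T,2T)/N_{ξ′}(T,2T) ≥ 0.85838`"
  (flat window), typed as the CLAIM `AlpogeFurman2026_xiDeriv_simple_critical_dyadic` of an
  UNREFEREED preprint (`[claim: AlpogeFurman2026, status: under-review]`; consumed below only as a
  hypothesis `(h : …)`), and
* the statement file `XiDerivativeZeros.lean` — J. B. Conrey, J. Number Theory 16 (1983) 49–74,
  Corollary (p. 50): the named fact `conrey1983_xiDeriv_one : 0.8137 ≤ κ′₁`,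
  `κ′₁ = xiDerivCriticalLineProportion 1 = liminf N^{(1)}₀(T)/N^{(1)}(T)`,

through the RH-free counting infrastructure for `ξ′` of `XiDerivativeZerosCounting.lean`
(finiteness of the boxes, `N^{(1)}(T) → ∞` by Hardy + Rolle, dyadic telescoping,
`le_xiDerivCriticalLineProportion_one_of_dyadic`, `XiDerivCount.eventually_cumulative_of_dyadic`):

* `AlpogeFurman2026_xiDeriv_simple_critical_dyadic.le_xiDerivCriticalLineProportion` — the claim
  gives `0.85838 ≤ κ′₁`;
* `conrey1983_xiDeriv_one_of_AlpogeFurman2026` — hence Conrey's `0.8137 ≤ κ′₁` (the named fact of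
  the refereed 1983 theorem follows from the unrefereed 2026 claim; compare
  `przz_bound_of_AlpogeFurman2026`, `CriticalLineTwoThirdsProportion.lean`, for `ζ`);
* `AlpogeFurman2026_xiDeriv_simple_critical_dyadic.cumulative` — the p. 2 sentence "the same holds
  for `(0,T)` in place of `(T,2T)`" in the `ξ′` setting: `(0.85838 − ε) N^{(1)}(T) ≤ #{simple zeros
  of ξ′ on the line up to T}` for all large `T`.

## Status note (no endorsement)

[AF26] is an unrefereed arXiv preprint (v1 13 Aug, v2 19 Aug 2026). Remark 7.1 is stated with "the
same argument applied to `ξ′`" and a pointer to the authors' Lean repository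
(`Zeta23.XiPrime.xiDeriv_simple_on_line`), which this tree has not replayed (D-0040). As the remark
itself records, for zeros of `ξ′` merely ON the line Wu 2015 (§3) has `0.86957` unconditionally and
Conrey 1983 has `0.8137`, so "claim ⟹ `conrey1983_xiDeriv_one`" is not a new record in print — the
new content of Remark 7.1 is the simplicity; in this tree the theorem ties an under-review claim to an
undischarged named fact and asserts neither. Nothing here bears on the truth of RH.

## References

* L. Alpöge, R. Furman, arXiv:2608.13637v2 (2026), Remark 7.1 (p. 14), p. 2. [`AlpogeFurman2026`]
* J. B. Conrey, J. Number Theory 16 (1983) 49–74, Corollary (p. 50). [`Conrey1983`]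
* X. Wu, Q. J. Math. 66 (2015) 759–771, §3 (comparandum quoted in [AF26]; not used).
-/

noncomputable section

open Filter Set

namespace Literature.NumberTheory.LFunctions

/-- **[AF26] Remark 7.1 ⟹ `κ′₁ ≥ 0.85838`**: from the claim
`AlpogeFurman2026_xiDeriv_simple_critical_dyadic` (at least `85.838 %` of the zeros of `ξ′` in
`(T, 2T]`, with multiplicity, are simple and on the line), the tree's proportion
`xiDerivCriticalLineProportion 1 = liminf N^{(1)}₀(T)/N^{(1)}(T)` is at least `0.85838`.
[cite: AlpogeFurman2026, Remark 7.1 (p. 14)] -/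
theorem AlpogeFurman2026_xiDeriv_simple_critical_dyadic.le_xiDerivCriticalLineProportion
    (h : AlpogeFurman2026_xiDeriv_simple_critical_dyadic) :
    (0.85838 : ℝ) ≤ xiDerivCriticalLineProportion 1 :=
  le_xiDerivCriticalLineProportion_one_of_dyadic h

/-- **[AF26] Remark 7.1 ⟹ Conrey 1983's Corollary for `ξ′`** (`conrey1983_xiDeriv_one`,
`0.8137 ≤ κ′₁`, `XiDerivativeZeros.lean`): `0.8137 < 0.85838`. The named fact of Conrey's (refereed,
1983) theorem thus follows from the (unrefereed, 2026) claim; neither is asserted here.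
[cite: AlpogeFurman2026, Remark 7.1 (p. 14): "previously 79.874 %", Conrey] -/
theorem conrey1983_xiDeriv_one_of_AlpogeFurman2026
    (h : AlpogeFurman2026_xiDeriv_simple_critical_dyadic) : conrey1983_xiDeriv_one :=
  le_trans (by norm_num) h.le_xiDerivCriticalLineProportion

/-- **[AF26] Remark 7.1, cumulative form** ("the same holds for `(0,T)` in place of `(T,2T)`",
p. 2, applied to `ξ′`): from the dyadic claim, for every `ε > 0` and all large `T`,
`(0.85838 − ε) N^{(1)}(T) ≤ #{s : ξ′(s) = 0, 0 < Im s ≤ T, Re s = ½, simple}`.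
[cite: AlpogeFurman2026, Remark 7.1 (p. 14) and p. 2] -/
theorem AlpogeFurman2026_xiDeriv_simple_critical_dyadic.cumulative
    (h : AlpogeFurman2026_xiDeriv_simple_critical_dyadic) :
    ∀ ε : ℝ, 0 < ε → ∀ᶠ T : ℝ in atTop,
      (0.85838 - ε) * (xiDerivZeroCount 1 T : ℝ) ≤
        (Set.ncard {s ∈ xiDerivZeroBox 1 T |
          s.re = 1 / 2 ∧ analyticOrderAt (iteratedDeriv 1 riemannXi) s = 1} : ℝ) :=
  XiDerivCount.eventually_cumulative_of_dyadic h

end Literature.NumberTheory.LFunctions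

end
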